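/-
Copyright (c) 2026 the pub-hodgecm-mathlib formalisation cell (harness21).  Prover seat hodgecm-mathlib-F0P3-p01 (g36), Track A «(D-RAM) FOUR-FRAME» squad, helper lane on
h413 = stmt-HodgeConjecture-24833 (count-neutral).  Dealer∕pen LH4-plan (g13) WORD #88 «(β-BAL) B2b-1 = F0P3-p01»; LH4-p11 (g8) SPEC-B2 v1 3227ed60 §3 (B2b-1).  2026-09-04.
-/
import Summits.HodgeConjecture.HodgeConjecture.Theorems.F0P3cDyRamLabelledOddOneSlotRead       -- PART 1 (this seat): `two_mul_labelledOddCount_eq_of_oneSlot_of_unit`, `labelledOddCount_div_relIndex_eq_of_oneSlot`; brings the DEFS leaf, ★ (B2a-3), ★ `fibre_isCoset_zero`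
import Summits.HodgeConjecture.HodgeConjecture.Theorems.F0P3cDyRamModelOneSlotLabel            -- ★ p859368 (L-lab-11) (LH4-p13 (g8)): `exists_generator_modelLabel_iff_of_snd_small` ∕ `_of_fst_small`
import Summits.HodgeConjecture.HodgeConjecture.Theorems.F0P3cDyRamSmulXPlusLabel               -- ★ (L-lab-3): `labelPlus_smul_xPlus_iff_exists_norm_of_congr`; brings ★ `valueSetMod_smul_xPlus_mul_norm`
import Summits.HodgeConjecture.HodgeConjecture.Theorems.F0P3cDyRamDiagonalKappaSplitCountEval    -- ★ `normSign_mul_self` (`ω(x)·ω(x) = 1`)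
import HarnessLib

/-!
# Crux `H413`, line LH4 «(D-RAM) FOUR-FRAME» — (β-BAL) B2b-1 «THE ONE-SLOT-DOMINANT ORBIT LABEL READ», PART 2: the value-class label of record on a one-slot-dominant
# normalised lattice IS a one-slot label (`ε = ω(e′)`), and the per-orbit term of the labelled Stage A there is `ω(e′)·ω(D_{1,i})∕2·[ω_iω_k ≡ 1 on S_F]·stabiliserWeight`

Cell `hodgecm-mathlib` (D-0151), FLOOR 0, crux item H413 = `stmt-HodgeConjecture-24833`, route `HCCMUnconditional`; squad F0∕P3c∕LH4.  THEOREMS ONLY (no `def`, no instance, no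
notation, no `sorry`, default heartbeats); ★-only imports; lane `--supports stmt-HodgeConjecture-24833 --as helper` (count-neutral); pays NO row, states NO law.

THE MATHEMATICS (SPEC-B2 v1 §3 (B2b-1); PART 1 = ★ `F0P3cDyRamLabelledOddOneSlotRead`: for a ONE-SLOT LABEL `Λ M₀ (D₁·u) ↔ ε·ω(u_k) = 1` on `S_F(M₀)` the labelled odd count is
`ε·ω(D_{1,i})·|A|∕2·[ω_iω_k ≡ 1 on S_F]`, `|A| = [S_F : N(S̃′)]`).
* §0  HEAD A at `i = k`: `2·m^Λ_k(M₀) = ε·ω(D_{1,k})·|A|` — «the same sign for every such orbit».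
* §4  HEAD B — THE LABEL READ (`Λ = valueClassLabel σ ϖ x₀ x₁ m* d`, `m* = d % 2 + 2d − 1`, complete sheet datum): on a NORMALISED `M₀ = latt A` whose slot-`j` norm-form term is
  `ϖ^{m*}`-negligible at `D₁` (`{j, k} = {0, 1}`), for every `u ∈ S_F(M₀)`: `Λ M₀ (D₁·u) ↔ ω(e′)·ω(u_k) = 1`, where `e′` is any `σ`-fixed unit with `D_{1,k}·x_k ≡ e′·t₊ (mod ϖ^{m*}·t₊…)`
  precisely `|(ϖ^{m*})⁻¹·(D_{1,k}x_k − e′t₊)| ≤ 1` — ★ (L-lab-11) reads the label as `LabelPlus ((e·N(s⋆)) • X₊)` with `e·t₊ = D_{1,k}u_k x_k`, the generator `s⋆` of the slot-`k`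
  coordinate image is a UNIT (normalised) and drops (★ `valueSetMod_smul_xPlus_mul_norm`), and ★ (L-lab-3) `labelPlus_smul_xPlus_iff_exists_norm_of_congr` decides the label of
  `(e₀u_k) • X₊` by the norm class of `e′u_k`.  So the L-sign of the word is `ε = ω(e′)` («`ω(D_{1,k}·x_k·g_k∕t₊)`», `g_k = N(s⋆)` a norm).
* §5  HEAD C: type `0`, `M₀ = latt g` normalised (`Pol₀ = D₁·S_F` by ★ `fibre_isCoset_zero`), slot `1` (resp. `0`) negligible ⟹
  `labelledOddCount σ ϖ 0 i Λ M₀ ∕ [𝒰 : N(S̃′(M₀))] = ω(e′)·ω(D_{1,i})∕2 · [∀ u ∈ S_F, ω(u_i)·ω(u_k) = 1] · stabiliserWeight σ M₀` — the per-orbit term of ★ (A_L) p860336.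
HONEST LABEL.  Count-neutral helper; proves no census: the eightfold vanishing, (β-BAL), (A″), (β), T₊ OPEN; `HC_CM` is proved only modulo the 7 printed citations (2 remaining
named inputs: hLiu418 = `stmt-HodgeConjecture-24832`, h413 = `stmt-HodgeConjecture-24833`) until rung 0 closes.

## References
* [Kottwitz1986BaseChangeUnits] R. E. Kottwitz, *Base change for unit elements of Hecke algebras*, Compositio Math. 60 (1986), §1 pp. 240–241.
* [Rogawski1990] J. D. Rogawski, *Automorphic Representations of Unitary Groups in Three Variables*, Ann. of Math. Stud. 123 (1990), §4.9 Prop. 4.9.1 (a)(b) p. 55, §4.10 p. 58.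
* [LanglandsShelstad1987] R. P. Langlands, D. Shelstad, *On the definition of transfer factors*, Math. Ann. 278 (1987), §3.
* [Serre1979] J.-P. Serre, *Local Fields*, GTM 67 (1979), Ch. I §1 (principal fractional ideals), Ch. V §3 Cor. 3 (norm classes of units).
-/

set_option autoImplicit false

noncomputable section

namespace Summit.HodgeConjecture.HodgeConjecture.Cruxes.H413.F0P3cDyRamLabelledOddOneSlotValueClass

open Literature.NumberTheory.Automorphic Literature.NumberTheory.Automorphic.HermitianLattice
open Literature.NumberTheory.Automorphic.UnitaryLatticeTree Literature.NumberTheory.Automorphic.UnitaryThreeFourFrame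
open Summit.HodgeConjecture.HodgeConjecture.Cruxes.H413.F0P3cDyRamFourFramePieces
open Summit.HodgeConjecture.HodgeConjecture.Cruxes.H413.F0P3cDyRamDiagonalTorusDefs
open Summit.HodgeConjecture.HodgeConjecture.Cruxes.H413.F0P3cDyRamLabelledOddCountDefs
open Summit.HodgeConjecture.HodgeConjecture.Cruxes.H413.F0P3cDyRamDiagonalOrbitFibreTransport
open Summit.HodgeConjecture.HodgeConjecture.Cruxes.H413.F0P3cDyRamStableSumSignClasses (normSign_eq_one_or)
open Summit.HodgeConjecture.HodgeConjecture.Cruxes.H413.F0P3cDyRamModelOneSlotLabel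
open Summit.HodgeConjecture.HodgeConjecture.Cruxes.H413.F0P3cDyRamFrameEltOneSlotLabel (valueSetMod_smul_xPlus_mul_norm)
open Summit.HodgeConjecture.HodgeConjecture.Cruxes.H413.F0P3cDyRamSmulXPlusLabel (labelPlus_smul_xPlus_iff_exists_norm_of_congr)
open Summit.HodgeConjecture.HodgeConjecture.Cruxes.H413.F0P3cDyRamLabelledOddOneSlotRead
open scoped Valued WithZero Matrix MatrixGroups

variable {K : Type} [Field K] [Valued K ℤᵐ⁰]

/-! ## §0  HEAD A at `i = k` -/

section HeadASelf

variable {σ : K →+* K} {ϖ : K} {tv : ℕ} {M₀ : Submodule 𝒪[K] (Fin 3 → K)} {D₁ : Fin 3 → K}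

/-- The same at `i = k`: `2 · labelledOddCount σ ϖ tv k Λ M₀ = ε · ω(D_{1,k}) · |A|`. [cite: Kottwitz1986BaseChangeUnits, §1 pp. 240–241] [cite: LanglandsShelstad1987, §3] -/
theorem two_mul_labelledOddCount_eq_of_oneSlot_self (hσ : ∀ x, σ (σ x) = x)
    {c : K} (hσc : σ c = c) (hcv : Valued.v c = 1) (hc : ¬ ∃ z : K, z * σ z = c)
    (hdich : ∀ x : K, σ x = x → x ≠ 0 → (∃ z : K, z * σ z = x) ∨ ∃ z : K, z * σ z = c * x)
    (hD₁ : ∀ j, σ (D₁ j) = D₁ j ∧ D₁ j ≠ 0) (hV₁ : IsVertexLattice σ ϖ (Matrix.diagonal D₁) tv M₀)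
    (hcoset : ∀ D : Fin 3 → K, (∀ j, σ (D j) = D j ∧ D j ≠ 0) →
      (IsVertexLattice σ ϖ (Matrix.diagonal D) tv M₀ ↔ ∃ u ∈ fixedUnitStabilizer σ M₀, ∀ j, D j = D₁ j * ((u j : Kˣ) : K)))
    (hA : ((unitStabilizer M₀).map (unitNormMap σ 3)).relIndex (fixedUnitStabilizer σ M₀) ≠ 0)
    (Λ : Submodule 𝒪[K] (Fin 3 → K) → (Fin 3 → K) → Prop) (k : Fin 3) {ε : ℤ} (hε : ε = 1 ∨ ε = -1)
    (hΛ : ∀ u ∈ fixedUnitStabilizer σ M₀, Λ M₀ (fun j => D₁ j * ((u j : Kˣ) : K)) ↔ ε * normSign σ ((u k : Kˣ) : K) = 1) :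
    2 * labelledOddCount σ ϖ tv k Λ M₀ =
      ε * normSign σ (D₁ k) * ((((unitStabilizer M₀).map (unitNormMap σ 3)).relIndex (fixedUnitStabilizer σ M₀) : ℕ) : ℤ) := by
  classical
  rw [two_mul_labelledOddCount_eq_of_oneSlot_of_unit hσ hσc hcv hc hdich hD₁ hV₁ hcoset hA Λ k k hε hΛ,
    if_pos (fun u _ => F0P3cDyRamDiagonalKappaSplitCountEval.normSign_mul_self σ _), mul_one]

end HeadASelf

/-! ## §4  HEAD B — the value-class label of record on a ONE-SLOT-DOMINANT normalised lattice is a one-slot label -/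

section HeadB

variable {σ : K →+* K} {ϖ : K} {d t : ℕ}

/-- `t₊ ≠ 0` for a ramified quadratic datum (`|ϖ − σϖ| = |ϖ|^d ≠ 0`). [cite: Serre1979, Ch. V §3 Cor. 3] -/
theorem tPlus_ne_zero (hD : IsRamifiedQuadraticDatum σ ϖ d t) : (ϖ - σ ϖ) * ((ϖ * σ ϖ) ^ ((d - d % 2) / 2))⁻¹ ≠ 0 := by
  have hϖv := hD.2.2.1; have hdiff := hD.2.2.2.2.1
  have hϖ0 : ϖ ≠ 0 := fun h => by rw [h, map_zero] at hϖv; exact WithZero.exp_ne_zero hϖv.symm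
  have hsub0 : ϖ - σ ϖ ≠ 0 := fun h => by
    rw [h, map_zero] at hdiff
    exact pow_ne_zero d ((Valuation.ne_zero_iff _).2 hϖ0) hdiff.symm
  exact mul_ne_zero hsub0 (inv_ne_zero (pow_ne_zero _ (mul_ne_zero hϖ0 ((map_ne_zero σ).2 hϖ0))))

/-- A generator `s⋆` of a coordinate image `{y_i | y ∈ M₀} = s⋆·𝒪` of a NORMALISED lattice is a unit. [cite: Serre1979, Ch. I §1] -/
theorem v_generator_eq_one_of_normalised {M₀ : Submodule 𝒪[K] (Fin 3 → K)} (hnorm : IsNormalisedLattice M₀) (i : Fin 3) {sStar : K}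
    (hgen : ∀ z : K, (∃ y ∈ M₀, y i = z) ↔ ∃ r : K, Valued.v r ≤ 1 ∧ z = sStar * r) : Valued.v sStar = 1 := by
  obtain ⟨hle, x, hxM, hx1⟩ := hnorm i
  apply le_antisymm
  · obtain ⟨y, hy, hy0⟩ := (hgen sStar).2 ⟨1, by rw [map_one], by rw [mul_one]⟩
    rw [← hy0]; exact hle y hy
  · obtain ⟨r, hr, hxr⟩ := (hgen (x i)).1 ⟨x, hxM, rfl⟩
    rw [← hx1, hxr, map_mul]
    exact mul_le_of_le_one_right zero_le hr

omit [Valued K ℤᵐ⁰] in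
/-- `∃ z, z·σz = x ↔ ω(x) = 1`. [cite: Serre1979, Ch. V §3 Cor. 3] -/
theorem exists_norm_iff_normSign_eq_one (σ : K →+* K) (x : K) : (∃ z : K, z * σ z = x) ↔ normSign σ x = 1 := by
  unfold normSign
  constructor
  · intro h; rw [if_pos h]
  · intro h; by_contra hne; rw [if_neg hne] at h; exact absurd h (by decide)

omit [Valued K ℤᵐ⁰] in
/-- Scalar bookkeeping for the congruence transport along `u_k`: `b·((a·t⁻¹·u − e·u)·t) = u·(b·(a − e·t))` (`t ≠ 0`). [cite: Serre1979, Ch. V §3 Cor. 3] -/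
theorem oneSlot_congr_identity {a b u e tp : K} (htp : tp ≠ 0) : b * ((a * tp⁻¹ * u - e * u) * tp) = u * (b * (a - e * tp)) := by
  field_simp

/-- **HEAD B (slot `1` negligible, read on slot `0`).**  Complete sheet datum `IsRamifiedQuadraticDatum σ ϖ d t`, `m* = d % 2 + 2d − 1`, `t₊ = (ϖ − σϖ)·(ϖσϖ)^{−(d−d%2)∕2}`, a
`σ`-fixed non-norm `c` with the dichotomy, `M₀ = latt A` NORMALISED, `D₁` a `σ`-fixed non-degenerate form, the slot-`1` term `ϖ^{m*}`-negligible at `D₁`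
(`∀ y ∈ latt A, |(ϖ^{m*})⁻¹·D_{1,1}x₁N(y₁)| ≤ 1`), and a `σ`-fixed unit `e′` with `|(ϖ^{m*})⁻¹·(D_{1,0}x₀ − e′t₊)| ≤ 1`.  Then for every `u ∈ S_F(M₀)`:
`valueClassLabel σ ϖ x₀ x₁ m* d M₀ (D₁·u) ↔ ω(e′)·ω(u₀) = 1` — the one-slot hypothesis of HEAD A with `k = 0`, `ε = ω(e′)`.  (★ (L-lab-11) `exists_generator_modelLabel_iff_of_snd_small`
reads the label as the value set of `e • X₊`, `e·t₊ = D_{1,0}u₀x₀·N(s⋆)`; `s⋆` is a unit and `N(s⋆)` drops by ★ `valueSetMod_smul_xPlus_mul_norm`; ★ (L-lab-3)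
`labelPlus_smul_xPlus_iff_exists_norm_of_congr` at the fixed unit `e′u₀`; multiplicativity of `ω`.) [cite: Rogawski1990, §4.9 Prop. 4.9.1 (b) p. 55] [cite: LanglandsShelstad1987, §3]
[cite: Serre1979, Ch. V §3 Cor. 3] [cite: Kottwitz1986BaseChangeUnits, §1 pp. 240–241] -/
theorem valueClassLabel_mul_iff_of_snd_small [IsAdicComplete 𝓂[K] 𝒪[K]] (hD : IsRamifiedQuadraticDatum σ ϖ d t)
    {c : K} (hσc : σ c = c) (hc : ¬ ∃ z : K, z * σ z = c)
    (hdich : ∀ x : K, σ x = x → x ≠ 0 → (∃ z : K, z * σ z = x) ∨ ∃ z : K, z * σ z = c * x)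
    (x₀ x₁ : K) (A : Matrix (Fin 3) (Fin 3) K) {M₀ : Submodule 𝒪[K] (Fin 3 → K)} (hM₀ : M₀ = latt A) (hnorm : IsNormalisedLattice M₀)
    {D₁ : Fin 3 → K} (hsmall : ∀ y ∈ latt A, Valued.v ((ϖ ^ (d % 2 + 2 * d - 1))⁻¹ * (D₁ 1 * x₁ * (y 1 * σ (y 1)))) ≤ 1)
    {e' : K} (hσe' : σ e' = e') (he'1 : Valued.v e' = 1)
    (hee : Valued.v ((ϖ ^ (d % 2 + 2 * d - 1))⁻¹ * (D₁ 0 * x₀ - e' * ((ϖ - σ ϖ) * ((ϖ * σ ϖ) ^ ((d - d % 2) / 2))⁻¹))) ≤ 1)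
    {u : Fin 3 → Kˣ} (hu : u ∈ fixedUnitStabilizer σ M₀) :
    valueClassLabel σ ϖ x₀ x₁ (d % 2 + 2 * d - 1) d M₀ (fun j => D₁ j * ((u j : Kˣ) : K)) ↔ normSign σ e' * normSign σ ((u 0 : Kˣ) : K) = 1 := by
  have htp0 := tPlus_ne_zero hD
  obtain ⟨-, hunit, hfix⟩ := (mem_fixedUnitStabilizer_iff σ M₀ u).1 hu
  -- negligibility at `D₁·u`
  have hsmall' : ∀ y ∈ latt A, Valued.v ((ϖ ^ (d % 2 + 2 * d - 1))⁻¹ * (D₁ 1 * ((u 1 : Kˣ) : K) * x₁ * (y 1 * σ (y 1)))) ≤ 1 := by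
    intro y hy
    have e1 : (ϖ ^ (d % 2 + 2 * d - 1))⁻¹ * (D₁ 1 * ((u 1 : Kˣ) : K) * x₁ * (y 1 * σ (y 1))) =
        ((u 1 : Kˣ) : K) * ((ϖ ^ (d % 2 + 2 * d - 1))⁻¹ * (D₁ 1 * x₁ * (y 1 * σ (y 1)))) := by ring
    rw [e1, map_mul, hunit 1, one_mul]; exact hsmall y hy
  obtain ⟨sStar, hgen, hiff⟩ := exists_generator_modelLabel_iff_of_snd_small σ ϖ d (d % 2 + 2 * d - 1) A 0 1
    (D₁ 0 * ((u 0 : Kˣ) : K) * x₀) (D₁ 1 * ((u 1 : Kˣ) : K) * x₁) hsmall'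
  have hs1 : Valued.v sStar = 1 := v_generator_eq_one_of_normalised hnorm 0 (fun z => by rw [hM₀]; exact hgen z)
  -- the one-slot scalar `e`, `e·t₊ = D_{1,0}u₀x₀·N(s⋆)`
  set e : K := D₁ 0 * ((u 0 : Kˣ) : K) * x₀ * (sStar * σ sStar) * ((ϖ - σ ϖ) * ((ϖ * σ ϖ) ^ ((d - d % 2) / 2))⁻¹)⁻¹ with hedef
  have he : e * ((ϖ - σ ϖ) * ((ϖ * σ ϖ) ^ ((d - d % 2) / 2))⁻¹) = D₁ 0 * ((u 0 : Kˣ) : K) * x₀ * (sStar * σ sStar) := by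
    rw [hedef, inv_mul_cancel_right₀ htp0]
  have key := hiff e he 1
  rw [one_smul] at key
  have hlab : valueClassLabel σ ϖ x₀ x₁ (d % 2 + 2 * d - 1) d M₀ (fun j => D₁ j * ((u j : Kˣ) : K)) ↔
      {z | ∃ y ∈ latt A, Valued.v ((ϖ ^ (d % 2 + 2 * d - 1))⁻¹ *
          (z - (D₁ 0 * ((u 0 : Kˣ) : K) * x₀ * (y 0 * σ (y 0)) + D₁ 1 * ((u 1 : Kˣ) : K) * x₁ * (y 1 * σ (y 1))))) ≤ 1} =
        valueSetMod σ ϖ (d % 2 + 2 * d - 1) (xPlus σ ϖ d) := by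
    rw [hM₀]; exact Iff.rfl
  rw [hlab, key]
  -- `e = (e₀·u₀)·N(s⋆)`: drop the unit norm, then ★ (L-lab-3) at the fixed unit `e′·u₀`
  have he2 : e = (D₁ 0 * x₀ * ((ϖ - σ ϖ) * ((ϖ * σ ϖ) ^ ((d - d % 2) / 2))⁻¹)⁻¹ * ((u 0 : Kˣ) : K)) * (sStar * σ sStar) := by
    rw [hedef]; ring
  rw [he2, valueSetMod_smul_xPlus_mul_norm σ ϖ d _ _ hs1]
  change LabelPlus σ ϖ d (d % 2 + 2 * d - 1) ((D₁ 0 * x₀ * ((ϖ - σ ϖ) * ((ϖ * σ ϖ) ^ ((d - d % 2) / 2))⁻¹)⁻¹ * ((u 0 : Kˣ) : K)) • xPlus σ ϖ d) ↔ _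
  have hσeu : σ (e' * ((u 0 : Kˣ) : K)) = e' * ((u 0 : Kˣ) : K) := by rw [map_mul, hσe', hfix 0]
  have heu1 : Valued.v (e' * ((u 0 : Kˣ) : K)) = 1 := by rw [map_mul, he'1, hunit 0, mul_one]
  have hcong : Valued.v ((ϖ ^ (d % 2 + 2 * d - 1))⁻¹ *
      ((D₁ 0 * x₀ * ((ϖ - σ ϖ) * ((ϖ * σ ϖ) ^ ((d - d % 2) / 2))⁻¹)⁻¹ * ((u 0 : Kˣ) : K) - e' * ((u 0 : Kˣ) : K)) *
        ((ϖ - σ ϖ) * ((ϖ * σ ϖ) ^ ((d - d % 2) / 2))⁻¹))) ≤ 1 := by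
    rw [oneSlot_congr_identity htp0, map_mul, hunit 0, one_mul]; exact hee
  rw [labelPlus_smul_xPlus_iff_exists_norm_of_congr hD hσeu heu1 hcong, exists_norm_iff_normSign_eq_one,
    F0P3cDyRamDiagonalKappaCountEval.normSign_mul_of_dichotomy σ hσc hc hdich hσe' (hfix 0) (fun h => by rw [h, map_zero] at he'1; exact zero_ne_one he'1) (u 0).ne_zero]

/-- **HEAD B (slot `0` negligible, read on slot `1`)** — the symmetric read: `valueClassLabel σ ϖ x₀ x₁ m* d M₀ (D₁·u) ↔ ω(e′)·ω(u₁) = 1` for a `σ`-fixed unit `e′` with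
`|(ϖ^{m*})⁻¹·(D_{1,1}x₁ − e′t₊)| ≤ 1` (★ (L-lab-11) `exists_generator_modelLabel_iff_of_fst_small`). [cite: Rogawski1990, §4.9 Prop. 4.9.1 (b) p. 55] [cite: LanglandsShelstad1987, §3]
[cite: Serre1979, Ch. V §3 Cor. 3] [cite: Kottwitz1986BaseChangeUnits, §1 pp. 240–241] -/
theorem valueClassLabel_mul_iff_of_fst_small [IsAdicComplete 𝓂[K] 𝒪[K]] (hD : IsRamifiedQuadraticDatum σ ϖ d t)
    {c : K} (hσc : σ c = c) (hc : ¬ ∃ z : K, z * σ z = c)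
    (hdich : ∀ x : K, σ x = x → x ≠ 0 → (∃ z : K, z * σ z = x) ∨ ∃ z : K, z * σ z = c * x)
    (x₀ x₁ : K) (A : Matrix (Fin 3) (Fin 3) K) {M₀ : Submodule 𝒪[K] (Fin 3 → K)} (hM₀ : M₀ = latt A) (hnorm : IsNormalisedLattice M₀)
    {D₁ : Fin 3 → K} (hsmall : ∀ y ∈ latt A, Valued.v ((ϖ ^ (d % 2 + 2 * d - 1))⁻¹ * (D₁ 0 * x₀ * (y 0 * σ (y 0)))) ≤ 1)
    {e' : K} (hσe' : σ e' = e') (he'1 : Valued.v e' = 1)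
    (hee : Valued.v ((ϖ ^ (d % 2 + 2 * d - 1))⁻¹ * (D₁ 1 * x₁ - e' * ((ϖ - σ ϖ) * ((ϖ * σ ϖ) ^ ((d - d % 2) / 2))⁻¹))) ≤ 1)
    {u : Fin 3 → Kˣ} (hu : u ∈ fixedUnitStabilizer σ M₀) :
    valueClassLabel σ ϖ x₀ x₁ (d % 2 + 2 * d - 1) d M₀ (fun j => D₁ j * ((u j : Kˣ) : K)) ↔ normSign σ e' * normSign σ ((u 1 : Kˣ) : K) = 1 := by
  have htp0 := tPlus_ne_zero hD
  obtain ⟨-, hunit, hfix⟩ := (mem_fixedUnitStabilizer_iff σ M₀ u).1 hu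
  have hsmall' : ∀ y ∈ latt A, Valued.v ((ϖ ^ (d % 2 + 2 * d - 1))⁻¹ * (D₁ 0 * ((u 0 : Kˣ) : K) * x₀ * (y 0 * σ (y 0)))) ≤ 1 := by
    intro y hy
    have e1 : (ϖ ^ (d % 2 + 2 * d - 1))⁻¹ * (D₁ 0 * ((u 0 : Kˣ) : K) * x₀ * (y 0 * σ (y 0))) =
        ((u 0 : Kˣ) : K) * ((ϖ ^ (d % 2 + 2 * d - 1))⁻¹ * (D₁ 0 * x₀ * (y 0 * σ (y 0)))) := by ring
    rw [e1, map_mul, hunit 0, one_mul]; exact hsmall y hy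
  obtain ⟨sStar, hgen, hiff⟩ := exists_generator_modelLabel_iff_of_fst_small σ ϖ d (d % 2 + 2 * d - 1) A 0 1
    (D₁ 0 * ((u 0 : Kˣ) : K) * x₀) (D₁ 1 * ((u 1 : Kˣ) : K) * x₁) hsmall'
  have hs1 : Valued.v sStar = 1 := v_generator_eq_one_of_normalised hnorm 1 (fun z => by rw [hM₀]; exact hgen z)
  set e : K := D₁ 1 * ((u 1 : Kˣ) : K) * x₁ * (sStar * σ sStar) * ((ϖ - σ ϖ) * ((ϖ * σ ϖ) ^ ((d - d % 2) / 2))⁻¹)⁻¹ with hedef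
  have he : e * ((ϖ - σ ϖ) * ((ϖ * σ ϖ) ^ ((d - d % 2) / 2))⁻¹) = D₁ 1 * ((u 1 : Kˣ) : K) * x₁ * (sStar * σ sStar) := by
    rw [hedef, inv_mul_cancel_right₀ htp0]
  have key := hiff e he 1
  rw [one_smul] at key
  have hlab : valueClassLabel σ ϖ x₀ x₁ (d % 2 + 2 * d - 1) d M₀ (fun j => D₁ j * ((u j : Kˣ) : K)) ↔
      {z | ∃ y ∈ latt A, Valued.v ((ϖ ^ (d % 2 + 2 * d - 1))⁻¹ *
          (z - (D₁ 0 * ((u 0 : Kˣ) : K) * x₀ * (y 0 * σ (y 0)) + D₁ 1 * ((u 1 : Kˣ) : K) * x₁ * (y 1 * σ (y 1))))) ≤ 1} =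
        valueSetMod σ ϖ (d % 2 + 2 * d - 1) (xPlus σ ϖ d) := by
    rw [hM₀]; exact Iff.rfl
  rw [hlab, key]
  have he2 : e = (D₁ 1 * x₁ * ((ϖ - σ ϖ) * ((ϖ * σ ϖ) ^ ((d - d % 2) / 2))⁻¹)⁻¹ * ((u 1 : Kˣ) : K)) * (sStar * σ sStar) := by
    rw [hedef]; ring
  rw [he2, valueSetMod_smul_xPlus_mul_norm σ ϖ d _ _ hs1]
  change LabelPlus σ ϖ d (d % 2 + 2 * d - 1) ((D₁ 1 * x₁ * ((ϖ - σ ϖ) * ((ϖ * σ ϖ) ^ ((d - d % 2) / 2))⁻¹)⁻¹ * ((u 1 : Kˣ) : K)) • xPlus σ ϖ d) ↔ _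
  have hσeu : σ (e' * ((u 1 : Kˣ) : K)) = e' * ((u 1 : Kˣ) : K) := by rw [map_mul, hσe', hfix 1]
  have heu1 : Valued.v (e' * ((u 1 : Kˣ) : K)) = 1 := by rw [map_mul, he'1, hunit 1, mul_one]
  have hcong : Valued.v ((ϖ ^ (d % 2 + 2 * d - 1))⁻¹ *
      ((D₁ 1 * x₁ * ((ϖ - σ ϖ) * ((ϖ * σ ϖ) ^ ((d - d % 2) / 2))⁻¹)⁻¹ * ((u 1 : Kˣ) : K) - e' * ((u 1 : Kˣ) : K)) *
        ((ϖ - σ ϖ) * ((ϖ * σ ϖ) ^ ((d - d % 2) / 2))⁻¹))) ≤ 1 := by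
    rw [oneSlot_congr_identity htp0, map_mul, hunit 1, one_mul]; exact hee
  rw [labelPlus_smul_xPlus_iff_exists_norm_of_congr hD hσeu heu1 hcong, exists_norm_iff_normSign_eq_one,
    F0P3cDyRamDiagonalKappaCountEval.normSign_mul_of_dichotomy σ hσc hc hdich hσe' (hfix 1) (fun h => by rw [h, map_zero] at he'1; exact zero_ne_one he'1) (u 1).ne_zero]

end HeadB

/-! ## §5  HEAD C — the per-orbit term of the labelled Stage A on a one-slot-dominant orbit of `𝓛₀(T)` -/

section HeadC

variable {σ : K →+* K} {ϖ : K} {d t : ℕ}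

open Classical in
/-- **HEAD C (type `0`, `M₀ = latt g` normalised — so `Pol₀(M₀) = D₁·S_F(M₀)` by ★ `fibre_isCoset_zero` —, slot `1` negligible):**
`labelledOddCount σ ϖ 0 i (valueClassLabel σ ϖ x₀ x₁ m* d) M₀ ∕ [𝒰 : N(S̃′(M₀))] = ω(e′)·ω(D_{1,i})∕2 · [∀ u ∈ S_F(M₀), ω(u_i)·ω(u_0) = 1] · stabiliserWeight σ M₀`
— the per-orbit term of ★ (A_L) p860336 on a one-slot-dominant orbit (HEAD A′ ∘ HEAD B). [cite: Kottwitz1986BaseChangeUnits, §1 pp. 240–241] [cite: Rogawski1990, §4.9 Prop. 4.9.1 (a)(b) p. 55]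
[cite: LanglandsShelstad1987, §3] -/
theorem labelledOddCount_valueClassLabel_div_relIndex_eq_of_snd_small [IsAdicComplete 𝓂[K] 𝒪[K]] (hD : IsRamifiedQuadraticDatum σ ϖ d t)
    {c : K} (hσc : σ c = c) (hcv : Valued.v c = 1) (hc : ¬ ∃ z : K, z * σ z = c)
    (hdich : ∀ x : K, σ x = x → x ≠ 0 → (∃ z : K, z * σ z = x) ∨ ∃ z : K, z * σ z = c * x)
    (x₀ x₁ : K) (g : GL (Fin 3) K) {M₀ : Submodule 𝒪[K] (Fin 3 → K)} (hM₀ : M₀ = latt (g : Matrix (Fin 3) (Fin 3) K)) (hnorm : IsNormalisedLattice M₀)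
    (hfin : {M : Submodule 𝒪[K] (Fin 3 → K) | ∃ u ∈ unitTorus K 3, M = mapGL (diagGLUnits u) M₀}.Finite)
    {D₁ : Fin 3 → K} (hD₁ : ∀ j, σ (D₁ j) = D₁ j ∧ D₁ j ≠ 0) (hV₁ : IsVertexLattice σ ϖ (Matrix.diagonal D₁) 0 M₀)
    (hsmall : ∀ y ∈ M₀, Valued.v ((ϖ ^ (d % 2 + 2 * d - 1))⁻¹ * (D₁ 1 * x₁ * (y 1 * σ (y 1)))) ≤ 1)
    {e' : K} (hσe' : σ e' = e') (he'1 : Valued.v e' = 1)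
    (hee : Valued.v ((ϖ ^ (d % 2 + 2 * d - 1))⁻¹ * (D₁ 0 * x₀ - e' * ((ϖ - σ ϖ) * ((ϖ * σ ϖ) ^ ((d - d % 2) / 2))⁻¹))) ≤ 1) (i : Fin 3) :
    (labelledOddCount σ ϖ 0 i (valueClassLabel σ ϖ x₀ x₁ (d % 2 + 2 * d - 1) d) M₀ : ℚ) /
        ((((unitStabilizer M₀).map (unitNormMap σ 3)).relIndex (fixedUnitTorus σ 3) : ℕ) : ℚ) =
      (normSign σ e' : ℚ) * (normSign σ (D₁ i) : ℚ) / 2 *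
        ((if ∀ u ∈ fixedUnitStabilizer σ M₀, normSign σ ((u i : Kˣ) : K) * normSign σ ((u 0 : Kˣ) : K) = 1 then 1 else 0 : ℤ) : ℚ) *
        stabiliserWeight σ M₀ := by
  have hσ := hD.1; have hvσ := hD.2.1
  exact labelledOddCount_div_relIndex_eq_of_oneSlot hσ hvσ hσc hcv hc hdich hfin hD₁ hV₁ (fibre_isCoset_zero hvσ ϖ g hM₀ hnorm D₁ hD₁ hV₁)
    (valueClassLabel σ ϖ x₀ x₁ (d % 2 + 2 * d - 1) d) i 0 (normSign_eq_one_or σ e')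
    (fun u hu => valueClassLabel_mul_iff_of_snd_small hD hσc hc hdich x₀ x₁ (g : Matrix (Fin 3) (Fin 3) K) hM₀ hnorm
      (fun y hy => hsmall y (hM₀ ▸ hy)) hσe' he'1 hee hu)

open Classical in
/-- **HEAD C (slot `0` negligible, read on slot `1`):**
`labelledOddCount σ ϖ 0 i (valueClassLabel σ ϖ x₀ x₁ m* d) M₀ ∕ [𝒰 : N(S̃′(M₀))] = ω(e′)·ω(D_{1,i})∕2 · [∀ u ∈ S_F(M₀), ω(u_i)·ω(u_1) = 1] · stabiliserWeight σ M₀`.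
[cite: Kottwitz1986BaseChangeUnits, §1 pp. 240–241] [cite: Rogawski1990, §4.9 Prop. 4.9.1 (a)(b) p. 55] [cite: LanglandsShelstad1987, §3] -/
theorem labelledOddCount_valueClassLabel_div_relIndex_eq_of_fst_small [IsAdicComplete 𝓂[K] 𝒪[K]] (hD : IsRamifiedQuadraticDatum σ ϖ d t)
    {c : K} (hσc : σ c = c) (hcv : Valued.v c = 1) (hc : ¬ ∃ z : K, z * σ z = c)
    (hdich : ∀ x : K, σ x = x → x ≠ 0 → (∃ z : K, z * σ z = x) ∨ ∃ z : K, z * σ z = c * x)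
    (x₀ x₁ : K) (g : GL (Fin 3) K) {M₀ : Submodule 𝒪[K] (Fin 3 → K)} (hM₀ : M₀ = latt (g : Matrix (Fin 3) (Fin 3) K)) (hnorm : IsNormalisedLattice M₀)
    (hfin : {M : Submodule 𝒪[K] (Fin 3 → K) | ∃ u ∈ unitTorus K 3, M = mapGL (diagGLUnits u) M₀}.Finite)
    {D₁ : Fin 3 → K} (hD₁ : ∀ j, σ (D₁ j) = D₁ j ∧ D₁ j ≠ 0) (hV₁ : IsVertexLattice σ ϖ (Matrix.diagonal D₁) 0 M₀)
    (hsmall : ∀ y ∈ M₀, Valued.v ((ϖ ^ (d % 2 + 2 * d - 1))⁻¹ * (D₁ 0 * x₀ * (y 0 * σ (y 0)))) ≤ 1)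
    {e' : K} (hσe' : σ e' = e') (he'1 : Valued.v e' = 1)
    (hee : Valued.v ((ϖ ^ (d % 2 + 2 * d - 1))⁻¹ * (D₁ 1 * x₁ - e' * ((ϖ - σ ϖ) * ((ϖ * σ ϖ) ^ ((d - d % 2) / 2))⁻¹))) ≤ 1) (i : Fin 3) :
    (labelledOddCount σ ϖ 0 i (valueClassLabel σ ϖ x₀ x₁ (d % 2 + 2 * d - 1) d) M₀ : ℚ) /
        ((((unitStabilizer M₀).map (unitNormMap σ 3)).relIndex (fixedUnitTorus σ 3) : ℕ) : ℚ) =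
      (normSign σ e' : ℚ) * (normSign σ (D₁ i) : ℚ) / 2 *
        ((if ∀ u ∈ fixedUnitStabilizer σ M₀, normSign σ ((u i : Kˣ) : K) * normSign σ ((u 1 : Kˣ) : K) = 1 then 1 else 0 : ℤ) : ℚ) *
        stabiliserWeight σ M₀ := by
  have hσ := hD.1; have hvσ := hD.2.1
  exact labelledOddCount_div_relIndex_eq_of_oneSlot hσ hvσ hσc hcv hc hdich hfin hD₁ hV₁ (fibre_isCoset_zero hvσ ϖ g hM₀ hnorm D₁ hD₁ hV₁)
    (valueClassLabel σ ϖ x₀ x₁ (d % 2 + 2 * d - 1) d) i 1 (normSign_eq_one_or σ e')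
    (fun u hu => valueClassLabel_mul_iff_of_fst_small hD hσc hc hdich x₀ x₁ (g : Matrix (Fin 3) (Fin 3) K) hM₀ hnorm
      (fun y hy => hsmall y (hM₀ ▸ hy)) hσe' he'1 hee hu)

end HeadC

end Summit.HodgeConjecture.HodgeConjecture.Cruxes.H413.F0P3cDyRamLabelledOddOneSlotValueClass

end
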